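import Summits.QuantumFields.BalabanUV.Beta.EriceRemainderEnclosureHistoryAutonomyComparisonAgeCompositionTwoPairsBandsA
import Summits.QuantumFields.BalabanUV.Beta.EriceRemainderEnclosureHistoryAutonomyComparisonAgeCompositionTwoPairsBandsB
import Summits.QuantumFields.BalabanUV.Beta.EriceRemainderEnclosureHistoryAutonomyComparisonAgeCompositionTwoPairsBandsC
import Summits.QuantumFields.BalabanUV.Beta.EriceRemainderEnclosureHistoryAutonomyComparisonAgeCompositionTwoPairsBandsD
import Summits.QuantumFields.BalabanUV.Beta.EriceRemainderEnclosureHistoryAutonomyComparisonAgeCompositionTwoPairsBandsE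
import Summits.QuantumFields.BalabanUV.Beta.EriceRemainderEnclosureHistoryAutonomyComparisonAgeCompositionTwoPairsBandsF
import Summits.QuantumFields.BalabanUV.Beta.EriceRemainderEnclosureHistoryAutonomyComparisonAgeCompositionTwoPairsBandsG
import Summits.QuantumFields.BalabanUV.Beta.EriceRemainderEnclosureHistoryAutonomyComparisonAgeCompositionTwoPairsBandsH
import Summits.QuantumFields.BalabanUV.Beta.EriceRemainderEnclosureHistoryAutonomyComparisonAgeCompositionTwoPairsBandsI
import Summits.QuantumFields.BalabanUV.Beta.EriceRemainderEnclosureHistoryAutonomyComparisonAgeCompositionThreeAgesFromFortyFive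

/-!
# EriceRemainderEnclosureHistoryAutonomyComparisonAgeCompositionThreeAgesFromSeventeen — (E93k) route (N), first order: THE CENSUS THREE AGES (1, k₂, k₃) AT EVERY OLD AGE FROM `k₂ ≥ 17`.
# **`flow_nonneg_census_three_ages_from_seventeen`: profile carried by (1, k₂, k₃), `17 ≤ k₂ < k₃ < K ≤ N` (horizon at least the range), EVERY
# admissible flow (isotone dominated memory with floor), EVERY damping of the self-consistent class `g_t(1+F_t) ≥ 1`: `0 ≤ ε ≤ e` at every pin — no
# displayed margin, whatever the total load.**  Dispatch: `k₂ ≥ 45` → (E92g) `…_from_fortyfive`; `k₃ ≤ 56` → (E90c) `flow_nonneg_three_ages` (the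
# MASS route, any damping; this is where `K ≤ N` enters); `k₃ ≥ 1600` → (E92g) `…_every_tail`; `2(k₂+1) ≤ k₃ ≤ 1599` → the 39 far bands of
# (E93d–h, l, m) by the group of `k₂` and the ratio `(k₃+1)∕(k₂+1)`; `57 ≤ k₃ ≤ 2k₂+1` (`k₂ ≥ 28`) → the 12 near bands of (E93i–j).  README g83∕e92 §6:
# after this file the census three ages are OPEN only for `2 ≤ k₂ ≤ 16` with `57 ≤ k₃ < T(k₂)` (`T = 1182 ∕ 1326 ∕ 1480` at `14 ∕ 15 ∕ 16`, `T_R2(k₂) ≤ 1047`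
# for `k₂ ≤ 13`) — about 10⁴ cells, numerically positive (g82)

Cell `pub-balaban`, β-function sub-cell, BINDER row D4 «RemainderConst leaves for Bałaban's split» (`HOME/BINDER-OWNERS.md`; owner lineage `b2b-balaban-beta-an4`;
this file by co-owner #2 lineage `b2b-balaban-beta-d4-p2`, generation 83), β-FLOW TEAM duty (1), FREEZE (0) honoured (def-free; nothing restated).

HONEST FRAMING (page 1, verbatim and binding).  *"Discharging BetaPertH makes Bałaban's UV stability UNCONDITIONAL — a real constructive-QFT result; it is
NOT the continuum limit and NOT the Clay problem."*  THIS FILE DISCHARGES NOTHING OF THE KIND.  Elementary real algebra ∕ real analysis about ABSTRACT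
functionals on a box ]0,γ]^ℕ with displayed floors, profiles and signs, and the FIRST-ORDER renewal objects of route (N) built from them — hypotheses of a
census, not facts; the form, signs, ages and moments of Bałaban's (1.22) limit functional are NOT PRINTED ([I] p. 298; GAPS G-t4-U2-1∕-2) and NOT asserted.
Row D4 class UNCHANGED (critical-path width 0; instance 0∕1; D4 DISCHARGE NO DATE); NOT B12 Thm 2, NOT BetaPertH, NOT continuum, NOT Clay.

WHAT IS PROVED ([folklore]; 0 `def`, 0 sorry).  **`flow_nonneg_census_three_ages_from_seventeen`**.
-/
noncomputable section
open Finset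

namespace Summit.QuantumFields.BalabanUV.Beta.EriceRemainderEnclosureHistoryAutonomyComparisonAgeCompositionThreeAgesFromSeventeen

open Literature.MathematicalPhysics.QuantumFieldTheory.Balaban1983to89
open Literature.MathematicalPhysics.QuantumFieldTheory.Balaban1983to89.T4BetaStationary
open Literature.MathematicalPhysics.QuantumFieldTheory.Balaban1983to89.T4BetaFlowWellPosed
open Summit.QuantumFields.BalabanUV.Beta.EriceRemainderEnclosureHistoryAutonomyComparisonAgeCompositionTwoPairsBandsA
  (joint_band_k18_19_r3_13_4 joint_band_k18_19_r13_4_7_2 joint_band_k18_19_r7_2_4 joint_band_k18_19_r4_5 joint_band_k18_19_r5_8 joint_band_k18_19_r8_33)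
open Summit.QuantumFields.BalabanUV.Beta.EriceRemainderEnclosureHistoryAutonomyComparisonAgeCompositionTwoPairsBandsB
  (joint_band_k18_19_r33_100 joint_band_k19_19_r29_10_16_5 joint_band_k20_22_r5_2_11_4 joint_band_k20_22_r11_4_3 joint_band_k20_22_r3_4 joint_band_k20_22_r4_7)
open Summit.QuantumFields.BalabanUV.Beta.EriceRemainderEnclosureHistoryAutonomyComparisonAgeCompositionTwoPairsBandsC
  (joint_band_k20_22_r7_27 joint_band_k20_22_r27_100 joint_band_k23_25_r2_5_2 joint_band_k23_25_r5_2_7_2 joint_band_k23_25_r7_2_7 joint_band_k23_25_r7_40)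
open Summit.QuantumFields.BalabanUV.Beta.EriceRemainderEnclosureHistoryAutonomyComparisonAgeCompositionTwoPairsBandsD
  (joint_band_k23_25_r40_100 joint_band_k26_29_r2_3 joint_band_k26_29_r3_6 joint_band_k26_29_r6_40 joint_band_k26_29_r40_100 joint_band_k30_34_r2_7_2)
open Summit.QuantumFields.BalabanUV.Beta.EriceRemainderEnclosureHistoryAutonomyComparisonAgeCompositionTwoPairsBandsE
  (joint_band_k30_34_r7_2_12 joint_band_k30_34_r12_100 joint_band_k35_39_r2_9_2 joint_band_k35_39_r9_2_33 joint_band_k35_39_r33_100 joint_band_k40_45_r2_5 joint_band_k40_45_r5_50)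
open Summit.QuantumFields.BalabanUV.Beta.EriceRemainderEnclosureHistoryAutonomyComparisonAgeCompositionTwoPairsBandsF
  (joint_near_band_k28_29_57_59 joint_near_band_k30_31_57_63 joint_near_band_k32_33_57_67 joint_near_band_k34_35_57_71 joint_near_band_k36_37_57_75 joint_near_band_k38_39_57_79)
open Summit.QuantumFields.BalabanUV.Beta.EriceRemainderEnclosureHistoryAutonomyComparisonAgeCompositionTwoPairsBandsG
  (joint_near_band_k40_41_57_70 joint_near_band_k40_41_71_83 joint_near_band_k42_43_57_72 joint_near_band_k42_43_73_87 joint_near_band_k44_44_57_73 joint_near_band_k44_44_74_89)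
open Summit.QuantumFields.BalabanUV.Beta.EriceRemainderEnclosureHistoryAutonomyComparisonAgeCompositionTwoPairsBandsH
  (joint_band_k17_17_r29_9_10_3 joint_band_k17_17_r10_3_7_2 joint_band_k17_17_r7_2_15_4 joint_band_k17_17_r15_4_17_4)
open Summit.QuantumFields.BalabanUV.Beta.EriceRemainderEnclosureHistoryAutonomyComparisonAgeCompositionTwoPairsBandsI
  (joint_band_k17_17_r17_4_11_2 joint_band_k17_17_r11_2_10 joint_band_k17_17_r10_50 joint_band_k17_17_r50_101)
open Summit.QuantumFields.BalabanUV.Beta.EriceRemainderEnclosureHistoryAutonomyComparisonAgeCompositionThreeAgesFromFortyFive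
  (flow_nonneg_census_three_ages_from_fortyfive flow_nonneg_census_three_ages_every_tail)
open Summit.QuantumFields.BalabanUV.Beta.EriceRemainderEnclosureHistoryAutonomyComparisonAgeCompositionThreeAgesTotalLoad (flow_nonneg_three_ages)

variable {B : (ℕ → ℝ) → ℝ} {γ b gIR : ℝ} {L : ℕ → ℝ} {K : ℕ} {h g : ℕ → ℝ}

/-- **THE CENSUS THREE AGES (1, k₂, k₃) AT EVERY OLD AGE FROM `k₂ ≥ 17`** (horizon `N ≥ K`; five typed regimes joined — see the module docstring
for the dispatch). [folklore] -/
theorem flow_nonneg_census_three_ages_from_seventeen (hmono : ∀ u v : ℕ → ℝ, SeqBox γ u → SeqBox γ v → (∀ j, u j ≤ v j) → B u ≤ B v)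
    (hL : ∀ k, 0 ≤ L k) (hb : 0 < b) (hlo : ∀ u, SeqBox γ u → b ≤ B u) (hdom : ∀ u, SeqBox γ u → ∑ k ∈ range K, L k * u k ≤ B u)
    (hh : SeqBox γ h) (hf : MemFlow B gIR h) (hg : ∀ t, 0 < g t ∧ g t ≤ 1)
    (hgF : ∀ t, 1 ≤ g t * (1 + ∑ k ∈ range K, L k * h (t + k) ^ 3 / 2))
    {k₂ k₃ : ℕ} (hk2 : 17 ≤ k₂) (hk23 : k₂ < k₃) (hk3K : k₃ < K) (hL3 : ∀ j, j < K → j ≠ 1 → j ≠ k₂ → j ≠ k₃ → L j = 0)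
    {N : ℕ} (hKN : K ≤ N) {KL : ℕ → ℕ → ℕ → ℝ}
    (hKL : ∀ k n l, KL k n l = if 0 < k ∧ k < K ∧ l < k then L k * h (n + k) ^ 3 / 2 * ∏ t ∈ Ico (n + 1 + l) (n + k + 1), g t else 0)
    {KA : ℕ → ℕ → ℕ → ℝ} {RA : ℕ → (ℕ → ℝ) → ℕ → ℝ}
    (hRA : ∀ i v m, RA i v m = ∑ l ∈ range K, KA i m l * v (m + 1 + l))
    (hKA : ∀ i m l, KA i m l = KL i m l + KA (i + 1) m l) (hKAtop : ∀ m l, KA K m l = 0)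
    {e ε : ℕ → ℝ} (he0 : ∀ m, 0 ≤ e m) (hea : ∀ m, e (m + 1) ≤ e m)
    (hεt : ∀ m, N < m → ε m = 0) (hεrec : ∀ m, ε m = e m - RA 1 ε m) : ∀ m, 0 ≤ ε m ∧ ε m ≤ e m := by
  by_cases h45 : 45 ≤ k₂
  · exact flow_nonneg_census_three_ages_from_fortyfive hmono hL hb hlo hdom hh hf hg hgF h45 hk23 hk3K hL3 hKL hRA hKA hKAtop he0 hea hεt hεrec
  by_cases h56 : k₃ ≤ 56
  · exact flow_nonneg_three_ages hmono hL hb hlo hdom hh hf hg (by omega) hk23 hk3K h56 hL3 hKN hKL hRA hKA hKAtop he0 hea hεt hεrec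
  by_cases h1600 : 1600 ≤ k₃
  · exact flow_nonneg_census_three_ages_every_tail hmono hL hb hlo hdom hh hf hg hgF (by omega) hk23 h1600 hk3K hL3 hKL hRA hKA hKAtop he0 hea hεt hεrec
  -- now 17 ≤ k₂ ≤ 44 and 57 ≤ k₃ ≤ 1599
  by_cases hfar : 2 * (k₂ + 1) ≤ k₃
  · -- THE FAR REGIME: bands of (E93d)–(E93h) by the group of k₂ and the ratio (k₃+1)∕(k₂+1)
    by_cases hg17 : k₂ ≤ 17
    · -- group 17 ≤ k₂ ≤ 17
      by_cases hb0 : 3 * (k₃ + 1) ≤ 10 * (k₂ + 1)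
      · exact joint_band_k17_17_r29_9_10_3 hmono hL hb hlo hdom hh hf hg hgF (by omega) (by omega) (by omega) (by omega) hk3K hL3 hKL hRA hKA hKAtop he0 hea hεt hεrec
      by_cases hb1 : 2 * (k₃ + 1) ≤ 7 * (k₂ + 1)
      · exact joint_band_k17_17_r10_3_7_2 hmono hL hb hlo hdom hh hf hg hgF (by omega) (by omega) (by omega) (by omega) hk3K hL3 hKL hRA hKA hKAtop he0 hea hεt hεrec
      by_cases hb2 : 4 * (k₃ + 1) ≤ 15 * (k₂ + 1)
      · exact joint_band_k17_17_r7_2_15_4 hmono hL hb hlo hdom hh hf hg hgF (by omega) (by omega) (by omega) (by omega) hk3K hL3 hKL hRA hKA hKAtop he0 hea hεt hεrec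
      by_cases hb3 : 4 * (k₃ + 1) ≤ 17 * (k₂ + 1)
      · exact joint_band_k17_17_r15_4_17_4 hmono hL hb hlo hdom hh hf hg hgF (by omega) (by omega) (by omega) (by omega) hk3K hL3 hKL hRA hKA hKAtop he0 hea hεt hεrec
      by_cases hb4 : 2 * (k₃ + 1) ≤ 11 * (k₂ + 1)
      · exact joint_band_k17_17_r17_4_11_2 hmono hL hb hlo hdom hh hf hg hgF (by omega) (by omega) (by omega) (by omega) hk3K hL3 hKL hRA hKA hKAtop he0 hea hεt hεrec
      by_cases hb5 : 1 * (k₃ + 1) ≤ 10 * (k₂ + 1)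
      · exact joint_band_k17_17_r11_2_10 hmono hL hb hlo hdom hh hf hg hgF (by omega) (by omega) (by omega) (by omega) hk3K hL3 hKL hRA hKA hKAtop he0 hea hεt hεrec
      by_cases hb6 : 1 * (k₃ + 1) ≤ 50 * (k₂ + 1)
      · exact joint_band_k17_17_r10_50 hmono hL hb hlo hdom hh hf hg hgF (by omega) (by omega) (by omega) (by omega) hk3K hL3 hKL hRA hKA hKAtop he0 hea hεt hεrec
      by_cases hb7 : 1 * (k₃ + 1) ≤ 101 * (k₂ + 1)
      · exact joint_band_k17_17_r50_101 hmono hL hb hlo hdom hh hf hg hgF (by omega) (by omega) (by omega) (by omega) hk3K hL3 hKL hRA hKA hKAtop he0 hea hεt hεrec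
      · exfalso; omega
    by_cases hg19 : k₂ ≤ 19
    · -- group 18 ≤ k₂ ≤ 19
      by_cases hsp : k₂ = 19 ∧ 5 * (k₃ + 1) ≤ 16 * (k₂ + 1)
      · obtain ⟨hsp1, hsp2⟩ := hsp
        exact joint_band_k19_19_r29_10_16_5 hmono hL hb hlo hdom hh hf hg hgF (by omega) (by omega) (by omega) hsp2 hk3K hL3 hKL hRA hKA hKAtop he0 hea hεt hεrec
      by_cases hb0 : 4 * (k₃ + 1) ≤ 13 * (k₂ + 1)
      · exact joint_band_k18_19_r3_13_4 hmono hL hb hlo hdom hh hf hg hgF (by omega) (by omega) (by omega) (by omega) hk3K hL3 hKL hRA hKA hKAtop he0 hea hεt hεrec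
      by_cases hb1 : 2 * (k₃ + 1) ≤ 7 * (k₂ + 1)
      · exact joint_band_k18_19_r13_4_7_2 hmono hL hb hlo hdom hh hf hg hgF (by omega) (by omega) (by omega) (by omega) hk3K hL3 hKL hRA hKA hKAtop he0 hea hεt hεrec
      by_cases hb2 : 1 * (k₃ + 1) ≤ 4 * (k₂ + 1)
      · exact joint_band_k18_19_r7_2_4 hmono hL hb hlo hdom hh hf hg hgF (by omega) (by omega) (by omega) (by omega) hk3K hL3 hKL hRA hKA hKAtop he0 hea hεt hεrec
      by_cases hb3 : 1 * (k₃ + 1) ≤ 5 * (k₂ + 1)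
      · exact joint_band_k18_19_r4_5 hmono hL hb hlo hdom hh hf hg hgF (by omega) (by omega) (by omega) (by omega) hk3K hL3 hKL hRA hKA hKAtop he0 hea hεt hεrec
      by_cases hb4 : 1 * (k₃ + 1) ≤ 8 * (k₂ + 1)
      · exact joint_band_k18_19_r5_8 hmono hL hb hlo hdom hh hf hg hgF (by omega) (by omega) (by omega) (by omega) hk3K hL3 hKL hRA hKA hKAtop he0 hea hεt hεrec
      by_cases hb5 : 1 * (k₃ + 1) ≤ 33 * (k₂ + 1)
      · exact joint_band_k18_19_r8_33 hmono hL hb hlo hdom hh hf hg hgF (by omega) (by omega) (by omega) (by omega) hk3K hL3 hKL hRA hKA hKAtop he0 hea hεt hεrec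
      by_cases hb6 : 1 * (k₃ + 1) ≤ 100 * (k₂ + 1)
      · exact joint_band_k18_19_r33_100 hmono hL hb hlo hdom hh hf hg hgF (by omega) (by omega) (by omega) (by omega) hk3K hL3 hKL hRA hKA hKAtop he0 hea hεt hεrec
      · exfalso; omega
    by_cases hg22 : k₂ ≤ 22
    · -- group 20 ≤ k₂ ≤ 22
      by_cases hb0 : 4 * (k₃ + 1) ≤ 11 * (k₂ + 1)
      · exact joint_band_k20_22_r5_2_11_4 hmono hL hb hlo hdom hh hf hg hgF (by omega) (by omega) (by omega) (by omega) hk3K hL3 hKL hRA hKA hKAtop he0 hea hεt hεrec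
      by_cases hb1 : 1 * (k₃ + 1) ≤ 3 * (k₂ + 1)
      · exact joint_band_k20_22_r11_4_3 hmono hL hb hlo hdom hh hf hg hgF (by omega) (by omega) (by omega) (by omega) hk3K hL3 hKL hRA hKA hKAtop he0 hea hεt hεrec
      by_cases hb2 : 1 * (k₃ + 1) ≤ 4 * (k₂ + 1)
      · exact joint_band_k20_22_r3_4 hmono hL hb hlo hdom hh hf hg hgF (by omega) (by omega) (by omega) (by omega) hk3K hL3 hKL hRA hKA hKAtop he0 hea hεt hεrec
      by_cases hb3 : 1 * (k₃ + 1) ≤ 7 * (k₂ + 1)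
      · exact joint_band_k20_22_r4_7 hmono hL hb hlo hdom hh hf hg hgF (by omega) (by omega) (by omega) (by omega) hk3K hL3 hKL hRA hKA hKAtop he0 hea hεt hεrec
      by_cases hb4 : 1 * (k₃ + 1) ≤ 27 * (k₂ + 1)
      · exact joint_band_k20_22_r7_27 hmono hL hb hlo hdom hh hf hg hgF (by omega) (by omega) (by omega) (by omega) hk3K hL3 hKL hRA hKA hKAtop he0 hea hεt hεrec
      by_cases hb5 : 1 * (k₃ + 1) ≤ 100 * (k₂ + 1)
      · exact joint_band_k20_22_r27_100 hmono hL hb hlo hdom hh hf hg hgF (by omega) (by omega) (by omega) (by omega) hk3K hL3 hKL hRA hKA hKAtop he0 hea hεt hεrec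
      · exfalso; omega
    by_cases hg25 : k₂ ≤ 25
    · -- group 23 ≤ k₂ ≤ 25
      by_cases hb0 : 2 * (k₃ + 1) ≤ 5 * (k₂ + 1)
      · exact joint_band_k23_25_r2_5_2 hmono hL hb hlo hdom hh hf hg hgF (by omega) (by omega) (by omega) (by omega) hk3K hL3 hKL hRA hKA hKAtop he0 hea hεt hεrec
      by_cases hb1 : 2 * (k₃ + 1) ≤ 7 * (k₂ + 1)
      · exact joint_band_k23_25_r5_2_7_2 hmono hL hb hlo hdom hh hf hg hgF (by omega) (by omega) (by omega) (by omega) hk3K hL3 hKL hRA hKA hKAtop he0 hea hεt hεrec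
      by_cases hb2 : 1 * (k₃ + 1) ≤ 7 * (k₂ + 1)
      · exact joint_band_k23_25_r7_2_7 hmono hL hb hlo hdom hh hf hg hgF (by omega) (by omega) (by omega) (by omega) hk3K hL3 hKL hRA hKA hKAtop he0 hea hεt hεrec
      by_cases hb3 : 1 * (k₃ + 1) ≤ 40 * (k₂ + 1)
      · exact joint_band_k23_25_r7_40 hmono hL hb hlo hdom hh hf hg hgF (by omega) (by omega) (by omega) (by omega) hk3K hL3 hKL hRA hKA hKAtop he0 hea hεt hεrec
      by_cases hb4 : 1 * (k₃ + 1) ≤ 100 * (k₂ + 1)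
      · exact joint_band_k23_25_r40_100 hmono hL hb hlo hdom hh hf hg hgF (by omega) (by omega) (by omega) (by omega) hk3K hL3 hKL hRA hKA hKAtop he0 hea hεt hεrec
      · exfalso; omega
    by_cases hg29 : k₂ ≤ 29
    · -- group 26 ≤ k₂ ≤ 29
      by_cases hb0 : 1 * (k₃ + 1) ≤ 3 * (k₂ + 1)
      · exact joint_band_k26_29_r2_3 hmono hL hb hlo hdom hh hf hg hgF (by omega) (by omega) (by omega) (by omega) hk3K hL3 hKL hRA hKA hKAtop he0 hea hεt hεrec
      by_cases hb1 : 1 * (k₃ + 1) ≤ 6 * (k₂ + 1)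
      · exact joint_band_k26_29_r3_6 hmono hL hb hlo hdom hh hf hg hgF (by omega) (by omega) (by omega) (by omega) hk3K hL3 hKL hRA hKA hKAtop he0 hea hεt hεrec
      by_cases hb2 : 1 * (k₃ + 1) ≤ 40 * (k₂ + 1)
      · exact joint_band_k26_29_r6_40 hmono hL hb hlo hdom hh hf hg hgF (by omega) (by omega) (by omega) (by omega) hk3K hL3 hKL hRA hKA hKAtop he0 hea hεt hεrec
      by_cases hb3 : 1 * (k₃ + 1) ≤ 100 * (k₂ + 1)
      · exact joint_band_k26_29_r40_100 hmono hL hb hlo hdom hh hf hg hgF (by omega) (by omega) (by omega) (by omega) hk3K hL3 hKL hRA hKA hKAtop he0 hea hεt hεrec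
      · exfalso; omega
    by_cases hg34 : k₂ ≤ 34
    · -- group 30 ≤ k₂ ≤ 34
      by_cases hb0 : 2 * (k₃ + 1) ≤ 7 * (k₂ + 1)
      · exact joint_band_k30_34_r2_7_2 hmono hL hb hlo hdom hh hf hg hgF (by omega) (by omega) (by omega) (by omega) hk3K hL3 hKL hRA hKA hKAtop he0 hea hεt hεrec
      by_cases hb1 : 1 * (k₃ + 1) ≤ 12 * (k₂ + 1)
      · exact joint_band_k30_34_r7_2_12 hmono hL hb hlo hdom hh hf hg hgF (by omega) (by omega) (by omega) (by omega) hk3K hL3 hKL hRA hKA hKAtop he0 hea hεt hεrec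
      by_cases hb2 : 1 * (k₃ + 1) ≤ 100 * (k₂ + 1)
      · exact joint_band_k30_34_r12_100 hmono hL hb hlo hdom hh hf hg hgF (by omega) (by omega) (by omega) (by omega) hk3K hL3 hKL hRA hKA hKAtop he0 hea hεt hεrec
      · exfalso; omega
    by_cases hg39 : k₂ ≤ 39
    · -- group 35 ≤ k₂ ≤ 39
      by_cases hb0 : 2 * (k₃ + 1) ≤ 9 * (k₂ + 1)
      · exact joint_band_k35_39_r2_9_2 hmono hL hb hlo hdom hh hf hg hgF (by omega) (by omega) (by omega) (by omega) hk3K hL3 hKL hRA hKA hKAtop he0 hea hεt hεrec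
      by_cases hb1 : 1 * (k₃ + 1) ≤ 33 * (k₂ + 1)
      · exact joint_band_k35_39_r9_2_33 hmono hL hb hlo hdom hh hf hg hgF (by omega) (by omega) (by omega) (by omega) hk3K hL3 hKL hRA hKA hKAtop he0 hea hεt hεrec
      by_cases hb2 : 1 * (k₃ + 1) ≤ 100 * (k₂ + 1)
      · exact joint_band_k35_39_r33_100 hmono hL hb hlo hdom hh hf hg hgF (by omega) (by omega) (by omega) (by omega) hk3K hL3 hKL hRA hKA hKAtop he0 hea hεt hεrec
      · exfalso; omega
    -- group 40 ≤ k₂ ≤ 44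
    by_cases hb0 : 1 * (k₃ + 1) ≤ 5 * (k₂ + 1)
    · exact joint_band_k40_45_r2_5 hmono hL hb hlo hdom hh hf hg hgF (by omega) (by omega) (by omega) (by omega) hk3K hL3 hKL hRA hKA hKAtop he0 hea hεt hεrec
    by_cases hb1 : 1 * (k₃ + 1) ≤ 50 * (k₂ + 1)
    · exact joint_band_k40_45_r5_50 hmono hL hb hlo hdom hh hf hg hgF (by omega) (by omega) (by omega) (by omega) hk3K hL3 hKL hRA hKA hKAtop he0 hea hεt hεrec
    · exfalso; omega
  · -- THE NEAR REGIME k₃ ≤ 2k₂+1 (so k₂ ≥ 28): bands of (E93i)–(E93j) by pairs of k₂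
    by_cases hp29 : k₂ ≤ 29
    · exact joint_near_band_k28_29_57_59 hmono hL hb hlo hdom hh hf hg hgF (by omega) (by omega) (by omega) (by omega) hk3K hL3 hKL hRA hKA hKAtop he0 hea hεt hεrec
    by_cases hp31 : k₂ ≤ 31
    · exact joint_near_band_k30_31_57_63 hmono hL hb hlo hdom hh hf hg hgF (by omega) (by omega) (by omega) (by omega) hk3K hL3 hKL hRA hKA hKAtop he0 hea hεt hεrec
    by_cases hp33 : k₂ ≤ 33
    · exact joint_near_band_k32_33_57_67 hmono hL hb hlo hdom hh hf hg hgF (by omega) (by omega) (by omega) (by omega) hk3K hL3 hKL hRA hKA hKAtop he0 hea hεt hεrec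
    by_cases hp35 : k₂ ≤ 35
    · exact joint_near_band_k34_35_57_71 hmono hL hb hlo hdom hh hf hg hgF (by omega) (by omega) (by omega) (by omega) hk3K hL3 hKL hRA hKA hKAtop he0 hea hεt hεrec
    by_cases hp37 : k₂ ≤ 37
    · exact joint_near_band_k36_37_57_75 hmono hL hb hlo hdom hh hf hg hgF (by omega) (by omega) (by omega) (by omega) hk3K hL3 hKL hRA hKA hKAtop he0 hea hεt hεrec
    by_cases hp39 : k₂ ≤ 39
    · exact joint_near_band_k38_39_57_79 hmono hL hb hlo hdom hh hf hg hgF (by omega) (by omega) (by omega) (by omega) hk3K hL3 hKL hRA hKA hKAtop he0 hea hεt hεrec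
    by_cases hp41 : k₂ ≤ 41
    · by_cases hq41 : k₃ ≤ 70
      · exact joint_near_band_k40_41_57_70 hmono hL hb hlo hdom hh hf hg hgF (by omega) (by omega) (by omega) (by omega) hk3K hL3 hKL hRA hKA hKAtop he0 hea hεt hεrec
      · exact joint_near_band_k40_41_71_83 hmono hL hb hlo hdom hh hf hg hgF (by omega) (by omega) (by omega) (by omega) hk3K hL3 hKL hRA hKA hKAtop he0 hea hεt hεrec
    by_cases hp43 : k₂ ≤ 43
    · by_cases hq43 : k₃ ≤ 72
      · exact joint_near_band_k42_43_57_72 hmono hL hb hlo hdom hh hf hg hgF (by omega) (by omega) (by omega) (by omega) hk3K hL3 hKL hRA hKA hKAtop he0 hea hεt hεrec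
      · exact joint_near_band_k42_43_73_87 hmono hL hb hlo hdom hh hf hg hgF (by omega) (by omega) (by omega) (by omega) hk3K hL3 hKL hRA hKA hKAtop he0 hea hεt hεrec
    by_cases hq44 : k₃ ≤ 73
    · exact joint_near_band_k44_44_57_73 hmono hL hb hlo hdom hh hf hg hgF (by omega) (by omega) (by omega) (by omega) hk3K hL3 hKL hRA hKA hKAtop he0 hea hεt hεrec
    · exact joint_near_band_k44_44_74_89 hmono hL hb hlo hdom hh hf hg hgF (by omega) (by omega) (by omega) (by omega) hk3K hL3 hKL hRA hKA hKAtop he0 hea hεt hεrec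

end Summit.QuantumFields.BalabanUV.Beta.EriceRemainderEnclosureHistoryAutonomyComparisonAgeCompositionThreeAgesFromSeventeen

end
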